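import Summits.ResolutionOfSingularities.ResolutionOfSingularities.Theorems.WildQuotientsSummitReductionStubPairOrbitNormalFormBlowupChartsOverCentreRsop
import Literature.AlgebraicGeometry.Resolution.FormalNormalCrossingsAlgebra
import Literature.AlgebraicGeometry.Resolution.AlterationsSemiStableCodimTwoBlowupFibreModels
import Literature.NumberTheory.GaloisRepresentations.NearlyOrdinaryPresentationProofs
import HarnessLib

/-!
# `WildQuotients.SummitReduction` (stmt-ResolutionOfSingularities-16324), line `FramePerfect`, stub O3
# (`stub_pair_orbitNormalFormBlowup_chartsOverCentre`): bookkeeping for the node data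

Route `ResolutionOfSingularities/WildQuotients`, crux `SummitReduction`; helper file of stub O3.
Small generic lemmas used to put the completed local ring at a node of the blown-up model into
de Jong's normal form `A'⟦U, V⟧/(UV - ∏_{i<s'} t'ᵢ)`, `Z' = V(∏_{i<r'} t'ᵢ)` (4.25/4.27): a
permutation of `Fin N` making two nested index sets initial segments
(`chartsOverCentre_exists_reindex`), a part of a regular system of parameters of full length
generates `𝔪`, products over initial segments under recasting, the structure map into the
completion as an anonymous homomorphism (instance-path hygiene), rescaling one member.

## Sources

* A. J. de Jong, *Smoothness, semi-stability and alterations*, Publ. Math. IHÉS 83 (1996), 4.25,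
  4.27, pp. 75–76. [DeJong1996]
-/

set_option linter.dupNamespace false -- the tree's summit namespace repeats `ResolutionOfSingularities`

noncomputable section

open IsLocalRing
open Literature.AlgebraicGeometry.Resolution
open Literature.NumberTheory.GaloisRepresentations.NearlyOrdinaryPresentationCA

namespace Summit.ResolutionOfSingularities.ResolutionOfSingularities.Theorems

/-- **Reindexing a family so that two nested index sets become initial segments**: for
`I ⊆ J ⊆ Fin N` there is a permutation `σ` of `Fin N` with `σ({i < |I|}) = I` and
`σ({i < |J|}) = J`, so that the products over the initial segments of `z ∘ σ` are the products
over `I` and `J` (used to put the branches through a node first, then the remaining boundary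
branches, in the normal form `uv = t₁ ⋯ t_s`, `Z = V(t₁ ⋯ t_r)`). [folklore] -/
theorem chartsOverCentre_exists_reindex {M : Type} [CommMonoid M] {N : ℕ} (z : Fin N → M)
    (I J : Finset (Fin N)) (hIJ : I ⊆ J) :
    ∃ σ : Fin N ≃ Fin N,
      (∏ i ∈ Finset.univ.filter (fun i : Fin N => i.val < I.card), z (σ i)) = ∏ i ∈ I, z i ∧
      (∏ i ∈ Finset.univ.filter (fun i : Fin N => i.val < J.card), z (σ i)) = ∏ i ∈ J, z i := by
  classical
  set a := I.card with ha
  set b := (J \ I).card with hb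
  set c := (Finset.univ \ J).card with hc
  have hab : a + b = J.card := by rw [ha, hb, add_comm, Finset.card_sdiff_add_card_eq_card hIJ]
  have hN : a + b + c = N := by
    rw [hab, hc, add_comm, Finset.card_sdiff_add_card_eq_card (Finset.subset_univ J), Finset.card_univ,
      Fintype.card_fin]
  -- the enumeration by blocks
  let f : Fin (a + b + c) → Fin N :=
    Fin.append (Fin.append (fun i => (I.orderIsoOfFin rfl i).1) (fun i => ((J \ I).orderIsoOfFin rfl i).1))
      (fun i => ((Finset.univ \ J).orderIsoOfFin rfl i).1)
  have hfI : ∀ i : Fin a, f (Fin.castAdd c (Fin.castAdd b i)) ∈ I := fun i => by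
    simp only [f, Fin.append_left]; exact (I.orderIsoOfFin rfl i).2
  have hfJI : ∀ i : Fin b, f (Fin.castAdd c (Fin.natAdd a i)) ∈ J \ I := fun i => by
    simp only [f, Fin.append_left, Fin.append_right]; exact ((J \ I).orderIsoOfFin rfl i).2
  have hfK : ∀ i : Fin c, f (Fin.natAdd (a + b) i) ∈ Finset.univ \ J := fun i => by
    simp only [f, Fin.append_right]; exact ((Finset.univ \ J).orderIsoOfFin rfl i).2
  have hfinj : Function.Injective f := by
    intro p q hpq
    induction p using Fin.addCases with
    | left p =>
      induction q using Fin.addCases with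
      | left q =>
        congr 1
        induction p using Fin.addCases with
        | left p =>
          induction q using Fin.addCases with
          | left q =>
            congr 1
            have := hpq
            simp only [f, Fin.append_left] at this
            exact (I.orderIsoOfFin rfl).injective (Subtype.ext this)
          | right q =>
            exact absurd (hfI p) (by rw [hpq]; exact (Finset.mem_sdiff.mp (hfJI q)).2)
        | right p =>
          induction q using Fin.addCases with
          | left q =>
            exact absurd (hfI q) (by rw [← hpq]; exact (Finset.mem_sdiff.mp (hfJI p)).2)
          | right q =>
            congr 1
            have := hpq
            simp only [f, Fin.append_left, Fin.append_right] at this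
            exact ((J \ I).orderIsoOfFin rfl).injective (Subtype.ext this)
      | right q =>
        exfalso
        have hq := (Finset.mem_sdiff.mp (hfK q)).2
        rw [← hpq] at hq
        induction p using Fin.addCases with
        | left p => exact hq (hIJ (hfI p))
        | right p => exact hq (Finset.mem_sdiff.mp (hfJI p)).1
    | right p =>
      induction q using Fin.addCases with
      | left q =>
        exfalso
        have hp := (Finset.mem_sdiff.mp (hfK p)).2
        rw [hpq] at hp
        induction q using Fin.addCases with
        | left q => exact hp (hIJ (hfI q))
        | right q => exact hp (Finset.mem_sdiff.mp (hfJI q)).1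
      | right q =>
        congr 1
        have := hpq
        simp only [f, Fin.append_right] at this
        exact ((Finset.univ \ J).orderIsoOfFin rfl).injective (Subtype.ext this)
  have hfbij : Function.Bijective f := by
    refine (Fintype.bijective_iff_injective_and_card f).mpr ⟨hfinj, ?_⟩
    simp [hN]
  let σ : Fin N ≃ Fin N := (finCongr hN).symm.trans (Equiv.ofBijective f hfbij)
  have hσ : ∀ i : Fin N, σ i = f (Fin.cast hN.symm i) := fun i => rfl
  refine ⟨σ, ?_, ?_⟩
  · have haN : a ≤ N := by omega
    rw [Finset.prod_filter_val_lt haN]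
    have h1 : ∀ i : Fin a, σ (Fin.castLE haN i) = (I.orderIsoOfFin rfl i).1 := by
      intro i
      rw [hσ, show Fin.cast hN.symm (Fin.castLE haN i) = Fin.castAdd c (Fin.castAdd b i) from Fin.ext rfl]
      simp only [f, Fin.append_left]
    simp_rw [h1]
    rw [← Finset.prod_coe_sort I]
    exact Fintype.prod_equiv (I.orderIsoOfFin rfl).toEquiv _ _ fun i => rfl
  · have hJN : J.card ≤ N := by omega
    rw [Finset.prod_filter_val_lt hJN]
    have hcast : a + b = J.card := hab
    -- split `Fin |J|` into the `I`-block and the `J ∖ I`-block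
    have h2 : ∏ i : Fin J.card, z (σ (Fin.castLE hJN i)) =
        ∏ i : Fin (a + b), z (σ (Fin.castLE hJN (Fin.cast hcast i))) :=
      (Fintype.prod_equiv (finCongr hcast) _ _ fun i => rfl).symm
    rw [h2, Fin.prod_univ_add]
    have hI' : ∀ i : Fin a, σ (Fin.castLE hJN (Fin.cast hcast (Fin.castAdd b i))) = (I.orderIsoOfFin rfl i).1 := by
      intro i
      rw [hσ, show Fin.cast hN.symm (Fin.castLE hJN (Fin.cast hcast (Fin.castAdd b i))) =
        Fin.castAdd c (Fin.castAdd b i) from Fin.ext rfl]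
      simp only [f, Fin.append_left]
    have hJI' : ∀ i : Fin b, σ (Fin.castLE hJN (Fin.cast hcast (Fin.natAdd a i))) = ((J \ I).orderIsoOfFin rfl i).1 := by
      intro i
      rw [hσ, show Fin.cast hN.symm (Fin.castLE hJN (Fin.cast hcast (Fin.natAdd a i))) =
        Fin.castAdd c (Fin.natAdd a i) from Fin.ext rfl]
      simp only [f, Fin.append_left, Fin.append_right]
    simp_rw [hI', hJI']
    rw [← Finset.prod_sdiff hIJ, mul_comm (∏ x ∈ J \ I, z x), ← Finset.prod_coe_sort I, ← Finset.prod_coe_sort (J \ I)]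
    congr 1
    · exact Fintype.prod_equiv (I.orderIsoOfFin rfl).toEquiv _ _ fun i => rfl
    · exact Fintype.prod_equiv ((J \ I).orderIsoOfFin rfl).toEquiv _ _ fun i => rfl

/-- A part of a regular system of parameters of full length `dim R` generates `𝔪`. [folklore] -/
theorem chartsOverCentre_span_eq_maximalIdeal_of_ringKrullDim {R : Type} [CommRing R] [IsLocalRing R]
    {n : ℕ} {z : Fin n → R} (hz : IsRsopPart z) (hdim : ringKrullDim R = n) :
    Ideal.span (Set.range z) = maximalIdeal R := by
  obtain ⟨_, e, y, hde, hspan⟩ := hz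
  rw [hdim] at hde
  have he : e = 0 := by
    have := WithBot.coe_eq_coe.mp hde
    have := ENat.coe_inj.mp this
    omega
  subst he
  rw [← hspan]
  congr 1
  rw [Set.range_eq_empty y, Set.union_empty]


/-- Products over an initial segment are insensitive to recasting the index type. [folklore] -/
theorem chartsOverCentre_prod_filter_lt_cast {M : Type} [CommMonoid M] {N N' : ℕ} (h : N = N') (g : Fin N' → M)
    (s : ℕ) (hs : s ≤ N) :
    ∏ i ∈ Finset.univ.filter (fun i : Fin N => i.val < s), (g ∘ Fin.cast h) i =
      ∏ i ∈ Finset.univ.filter (fun i : Fin N' => i.val < s), g i := by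
  rw [Finset.prod_filter_val_lt hs, Finset.prod_filter_val_lt (h ▸ hs)]
  rfl



/-- The structure map into the completion, as an anonymous ring homomorphism (to keep the
instance path of `LocalCpl` of a localisation of a subalgebra under control). [folklore] -/
theorem chartsOverCentre_exists_ofLocalCpl (R : Type) [CommRing R] [IsLocalRing R] [IsNoetherianRing R] :
    ∃ f : R →+* LocalCpl R, (∀ r, f r = algebraMap R (LocalCpl R) r) ∧
      ∀ {n : ℕ} {z : Fin n → R}, IsRsopPart z → IsRsopPart (f ∘ z) :=
  ⟨_, fun _ => rfl, fun hz => chartsOverCentre_isRsopPart_adicCompletion hz⟩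


/-- Rescaling one member of a family by a factor. [folklore] -/
theorem chartsOverCentre_exists_update_mul {M : Type} [CommMonoid M] {N : ℕ} (xx : Fin N → M) (j : Fin N) (u : M) :
    ∃ xx' : Fin N → M, xx' j = u * xx j ∧ ∀ i, i ≠ j → xx' i = xx i := by
  classical
  exact ⟨Function.update xx j (u * xx j), Function.update_self _ _ _, fun i hi => Function.update_of_ne hi _ _⟩


end Summit.ResolutionOfSingularities.ResolutionOfSingularities.Theorems

end
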